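import Mathlib
import Summits.ValiantsHypothesis.ValiantsHypothesis.Theorems.NNDivisionHard.Negative.LocatedPencilLawFalseCake

/-!
# KILL NOTE N22, kernel part 4c — `locatedPencilLaw_false` (crux `FifoMatching.NNDivisionHard`,
# stmt-ValiantsHypothesis-21181; Negative lane)
val-idea-crit-9 g2 (critic of record, WAVE 6; director RULING R316).

**Refutes `CliqueRowBlind.LocatedPencilLaw` (= `entryTilted.Law`, C⁺_entry) [refuted-misstated].**  The law says:
for every `poly`-xc passenger `Q`, if the augmented located-pencil slack of `COR(n) + Q` — rows `(a, W)` with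
functional `udRow a + flat W` and the BOX right-hand side `1 + Σ_{i,m} max(W_im, 0)`, plus the exact passenger
maximum — factors nonnegatively through `r + 1` slots, then `T c n = 2^{(log₂ n + c)^c} < r`.  Witness: the
permutahedral passenger `Q^Π_λ = conv{qPerm n λ π}` (`λ = 16 n`, xc `≤ n²`, `hasEFOfSize_qPerm`), whose located
slack has an explicit nonnegative factorization with `|TSlot n| = 8n⁴ + 28n³ + 36n² + 16n + 2` slots
(`rep_Gfun` for the diagonal layer, two more slot families for the off-diagonal entries), while `T 3 n ≥ 2^27`.
Repaired statement C′ (believed true, NOT refuted by this witness): `ExactPencilLaw` of `Cruxes/…/ExactPencil38.lean`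
≡ `pinnedRows.Law` of `Cruxes/…/LocatedRows.lean` (exact right-hand sides `max_{x ∈ COR} ⟨ρ, x⟩` instead of the box
bound; `exactTilted_law_holds_on_qPerm` shows the witness misses C′).  The misstatement is the box right-hand side on
sign patterns of `W` that no clique realizes (`hCOR_eq_box_iff`).  Theorems only; VP ≠ VNP is NOT proved; the crux
`NNDivisionHard` stays OPEN.
-/

namespace Summit.ValiantsHypothesis.Theorems.NNDivisionHardNegative.LocatedPencil

open Matrix Finset
open Literature.Barriers.PneNP (HasEFOfSize)
open Literature.Combinatorics.Optimization.FixedSizePsdRank (flat)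
open Summit.ValiantsHypothesis.ValiantsHypothesis.Theorems.FifoMatching.XcDivision (udInd udInd_apply udInd_sq udPt udRow)
open Summit.ValiantsHypothesis.Theorems.NNDivisionHardNegative.DiagTilted (udInd_nonneg' udInd_le_one')

noncomputable section

variable {n : ℕ}

/-! ## §1 Off-diagonal slots -/

/-- off-diagonal slots: `(i, m)` for `W⁺_im (1 − b_i b_m)` and for `W⁻_im b_i b_m`. -/
abbrev OSlot (n : ℕ) := (Fin n × Fin n) ⊕ (Fin n × Fin n)

/-- all slots of the certificate. -/
abbrev TSlot (n : ℕ) := DSlot n ⊕ OSlot n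

/-- off-diagonal row coefficients `W⁺_im`, `W⁻_im` (`i ≠ m`). -/
def offU (W : Matrix (Fin n) (Fin n) ℝ) : OSlot n → ℝ :=
  Sum.elim (fun p => if p.1 = p.2 then 0 else max (W p.1 p.2) 0)
    (fun p => if p.1 = p.2 then 0 else max (-(W p.1 p.2)) 0)

/-- off-diagonal column functions `1 − b_i b_m`, `b_i b_m`. -/
def offV (b : Finset (Fin n)) : OSlot n → ℝ :=
  Sum.elim (fun p => 1 - udInd b p.1 * udInd b p.2) (fun p => udInd b p.1 * udInd b p.2)

/-- `offU ≥ 0`. -/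
theorem offU_nonneg (W : Matrix (Fin n) (Fin n) ℝ) (s : OSlot n) : 0 ≤ offU W s := by
  rcases s with p | p
  · show 0 ≤ (if p.1 = p.2 then (0 : ℝ) else max (W p.1 p.2) 0)
    split_ifs
    · exact le_rfl
    · exact le_max_right _ _
  · show 0 ≤ (if p.1 = p.2 then (0 : ℝ) else max (-(W p.1 p.2)) 0)
    split_ifs
    · exact le_rfl
    · exact le_max_right _ _

/-- `offV ≥ 0`. -/
theorem offV_nonneg (b : Finset (Fin n)) (s : OSlot n) : 0 ≤ offV b s := by
  rcases s with p | p
  · exact sub_nonneg.2 (mul_le_one₀ (udInd_le_one' b p.1) (udInd_nonneg' b p.2) (udInd_le_one' b p.2))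
  · exact mul_nonneg (udInd_nonneg' b p.1) (udInd_nonneg' b p.2)

/-- the off-diagonal pairing as a double sum. -/
theorem sum_offU_offV (W : Matrix (Fin n) (Fin n) ℝ) (b : Finset (Fin n)) :
    ∑ s, offU W s * offV b s = ∑ i, ∑ m, (if i = m then (0 : ℝ) else
      (max (W i m) 0 * (1 - udInd b i * udInd b m) + max (-(W i m)) 0 * (udInd b i * udInd b m))) := by
  simp only [Fintype.sum_sum_type, offU, offV, Sum.elim_inl, Sum.elim_inr, Fintype.sum_prod_type]
  rw [← Finset.sum_add_distrib]
  refine Finset.sum_congr rfl fun i _ => ?_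
  rw [← Finset.sum_add_distrib]
  refine Finset.sum_congr rfl fun m _ => ?_
  split_ifs <;> ring

/-- pointwise split of `max(W_im, 0) − W_im b_i b_m` into the diagonal read and the off-diagonal slots. -/
theorem entry_split (W : Matrix (Fin n) (Fin n) ℝ) (b : Finset (Fin n)) (i m : Fin n) :
    max (W i m) 0 - W i m * (udInd b i * udInd b m)
      = (if i = m then max (W i i) 0 - W i i * udInd b i else 0)
        + (if i = m then (0 : ℝ) else
            (max (W i m) 0 * (1 - udInd b i * udInd b m) + max (-(W i m)) 0 * (udInd b i * udInd b m))) := by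
  by_cases h : i = m
  · subst h
    rw [if_pos rfl, if_pos rfl, udInd_sq]; ring
  · rw [if_neg h, if_neg h]
    linear_combination (udInd b i * udInd b m) * max_zero_sub_max_neg_zero_eq_self (W i m)

/-- **slack identity**: the augmented located-pencil slack of the row `(a, W)` against the column `(b, π)` is the
diagonal layer `Gfun a (𝟙_a + diag W)` plus the off-diagonal slots. -/
theorem slack_eq (a : Finset (Fin n)) (W : Matrix (Fin n) (Fin n) ℝ) (b : Finset (Fin n))
    (π : Equiv.Perm (Fin n)) :
    ((1 + ∑ i, ∑ m, max (W i m) 0) + -(lam n * pmin (fun i => udInd a i + W i i)))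
        - (udRow a + flat W) ⬝ᵥ (udPt b + qPerm n (lam n) π)
      = Gfun a (fun i => udInd a i + W i i) b π + ∑ s, offU W s * offV b s := by
  rw [dotProduct_add, rho_dotProduct_udPt, rho_dotProduct_qPerm, sum_offU_offV]
  unfold Gfun
  simp only [add_sub_cancel_left]
  have hsplit : ∑ i, ∑ m, max (W i m) 0 - ∑ i, ∑ m, W i m * (udInd b i * udInd b m)
      = ∑ i, (max (W i i) 0 - W i i * udInd b i)
        + ∑ i, ∑ m, (if i = m then (0 : ℝ) else
            (max (W i m) 0 * (1 - udInd b i * udInd b m) + max (-(W i m)) 0 * (udInd b i * udInd b m))) := by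
    rw [← Finset.sum_sub_distrib, ← Finset.sum_add_distrib]
    refine Finset.sum_congr rfl fun i _ => ?_
    rw [← Finset.sum_sub_distrib]
    simp only [entry_split W b i]
    rw [Finset.sum_add_distrib, Finset.sum_ite_eq, if_pos (Finset.mem_univ i)]
  linear_combination hsplit

/-! ## §2 Rows and columns of the certificate -/

/-- the passenger maximum of the row `(a, W)` over `Q^Π_λ`: `−λ · pmin(𝟙_a + diag W)`. -/
def mrow (a : Finset (Fin n) × Matrix (Fin n) (Fin n) ℝ) : ℝ := -(lam n * pmin (fun i => udInd a.1 i + a.2 i i))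

/-- `⟨ρ_a, q_π⟩ ≤ mrow a`. -/
theorem rho_q_le_mrow (a : Finset (Fin n) × Matrix (Fin n) (Fin n) ℝ) (π : Equiv.Perm (Fin n)) :
    (udRow a.1 + flat a.2) ⬝ᵥ qPerm n (lam n) π ≤ mrow a := by
  rw [rho_dotProduct_qPerm, mrow, neg_le_neg_iff]
  exact mul_le_mul_of_nonneg_left (pmin_le _ π) lam_nonneg

/-- the maximum is attained. -/
theorem exists_rho_q_eq_mrow (a : Finset (Fin n) × Matrix (Fin n) (Fin n) ℝ) :
    ∃ π : Equiv.Perm (Fin n), (udRow a.1 + flat a.2) ⬝ᵥ qPerm n (lam n) π = mrow a := by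
  obtain ⟨π, hπ⟩ := exists_pval_eq_pmin (fun i => udInd a.1 i + a.2 i i)
  exact ⟨π, by rw [rho_dotProduct_qPerm, mrow, hπ]⟩

/-- row coefficients on all slots (diagonal layer from `rep_Gfun`, off-diagonal from `offU`). -/
def Urow (a : Finset (Fin n) × Matrix (Fin n) (Fin n) ℝ) : TSlot n → ℝ :=
  Sum.elim (Classical.choose (rep_Gfun a.1 (fun i => udInd a.1 i + a.2 i i))) (offU a.2)

/-- column functions on all slots. -/
def Vcol (b : Finset (Fin n)) (π : Equiv.Perm (Fin n)) : TSlot n → ℝ := Sum.elim (dcolV b π) (offV b)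

/-- `Urow ≥ 0`. -/
theorem Urow_nonneg (a : Finset (Fin n) × Matrix (Fin n) (Fin n) ℝ) (s : TSlot n) : 0 ≤ Urow a s := by
  rcases s with s | s
  · exact (Classical.choose_spec (rep_Gfun a.1 (fun i => udInd a.1 i + a.2 i i))).1 s
  · exact offU_nonneg a.2 s

/-- `Vcol ≥ 0` (for `n ≥ 1`). -/
theorem Vcol_nonneg (hn : 1 ≤ n) (b : Finset (Fin n)) (π : Equiv.Perm (Fin n)) (s : TSlot n) :
    0 ≤ Vcol b π s := by
  rcases s with s | s
  · exact dcolV_nonneg hn b π s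
  · exact offV_nonneg b s

/-- ★ **the certificate**: the augmented located-pencil slack factors through `TSlot n`. -/
theorem slack_factor (a : Finset (Fin n) × Matrix (Fin n) (Fin n) ℝ) (b : Finset (Fin n))
    (π : Equiv.Perm (Fin n)) :
    ((1 + ∑ i, ∑ m, max (a.2 i m) 0) + mrow a) - (udRow a.1 + flat a.2) ⬝ᵥ (udPt b + qPerm n (lam n) π)
      = ∑ s, Urow a s * Vcol b π s := by
  rw [mrow, slack_eq a.1 a.2 b π, (Classical.choose_spec (rep_Gfun a.1 (fun i => udInd a.1 i + a.2 i i))).2 b π,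
    Fintype.sum_sum_type (fun s : TSlot n => Urow a s * Vcol b π s)]
  simp only [Urow, Vcol, Sum.elim_inl, Sum.elim_inr]

/-! ## §3 The slot budget -/

/-- `|TSlot n| = 8n⁴ + 28n³ + 36n² + 16n + 2`. -/
theorem card_TSlot (n : ℕ) : Fintype.card (TSlot n) = 8 * n ^ 4 + 28 * n ^ 3 + 36 * n ^ 2 + 16 * n + 2 := by
  simp only [TSlot, DSlot, OSlot, Slot, BlkIx, Rix, Fintype.card_sum, Fintype.card_prod, Fintype.card_fin,
    Fintype.card_option, Fintype.card_unit]
  ring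

/-- the budget: `|TSlot n| ≤ 2^{(log₂ n + 3)^3} = T 3 n`. -/
theorem card_TSlot_le_T_three (n : ℕ) :
    8 * n ^ 4 + 28 * n ^ 3 + 36 * n ^ 2 + 16 * n + 2 ≤ 2 ^ ((Nat.log 2 n + 3) ^ 3) := by
  have hlt : n < 2 ^ (Nat.log 2 n + 1) := Nat.lt_pow_succ_log_self (by norm_num) n
  set L := Nat.log 2 n with hL
  have h1 : 8 * n ^ 4 + 28 * n ^ 3 + 36 * n ^ 2 + 16 * n + 2 ≤ 32 * (n + 1) ^ 4 := by
    have : 32 * (n + 1) ^ 4 = (8 * n ^ 4 + 28 * n ^ 3 + 36 * n ^ 2 + 16 * n + 2)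
        + (24 * n ^ 4 + 100 * n ^ 3 + 156 * n ^ 2 + 112 * n + 30) := by ring
    omega
  have h2 : (n + 1) ^ 4 ≤ (2 ^ (L + 1)) ^ 4 := Nat.pow_le_pow_left (by omega) 4
  have h3 : 32 * (2 ^ (L + 1)) ^ 4 = 2 ^ (4 * L + 9) := by ring
  have h4 : 2 ^ (4 * L + 9) ≤ 2 ^ ((L + 3) ^ 3) :=
    Nat.pow_le_pow_right (by norm_num) (by nlinarith [pow_nonneg (Nat.zero_le L) 3, pow_nonneg (Nat.zero_le L) 2])
  omega

/-! ## §4 The law `C⁺_entry` is false -/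

/-- ★★★ **`LocatedPencilLaw` (C⁺_entry = `CliqueRowBlind.entryTilted.Law`) is FALSE** — the statement below is
`entryTilted.Law` verbatim, unfolded (rows `(a, W) : Finset (Fin n) × Matrix (Fin n) (Fin n) ℝ`, functional
`udRow a + flat W`, right-hand side `1 + Σ_i Σ_m max (W i m) 0`, `T c n = 2^{(log₂ n + c)^c}`).  Class
`refuted-misstated`; repaired statement C′ = `ExactPencilLaw` ≡ `pinnedRows.Law` (exact right-hand sides), which
this witness does not refute. -/
theorem locatedPencilLaw_false :
    ¬ (∀ c : ℕ, ∃ n₀ : ℕ, ∀ n ≥ n₀, ∀ (K : ℕ) (q : Fin (K + 1) → (Fin (n * n) → ℝ)) (r : ℕ),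
        HasEFOfSize (convexHull ℝ (Set.range q)) r →
        ∀ m : Finset (Fin n) × Matrix (Fin n) (Fin n) ℝ → ℝ,
          (∀ a j, (udRow a.1 + flat a.2) ⬝ᵥ q j ≤ m a) →
          (∀ a, ∃ j, (udRow a.1 + flat a.2) ⬝ᵥ q j = m a) →
        ∀ (U : Finset (Fin n) × Matrix (Fin n) (Fin n) ℝ → Option (Fin r) → ℝ)
          (V : Finset (Fin n) × Fin (K + 1) → Option (Fin r) → ℝ),
          (∀ a i, 0 ≤ U a i) → (∀ p i, 0 ≤ V p i) →
          (∀ a b j, ((1 + ∑ i, ∑ m, max (a.2 i m) 0) + m a) - (udRow a.1 + flat a.2) ⬝ᵥ (udPt b + q j)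
              = ∑ i, U a i * V (b, j) i) →
          2 ^ ((Nat.log 2 n + c) ^ c) < r) := by
  classical
  intro hL
  obtain ⟨n₀, hn₀⟩ := hL 3
  obtain ⟨n, hnn₀, hn1⟩ : ∃ n, n₀ ≤ n ∧ 1 ≤ n := ⟨max n₀ 1, le_max_left _ _, le_max_right _ _⟩
  have hK : Fintype.card (Equiv.Perm (Fin n)) = (Fintype.card (Equiv.Perm (Fin n)) - 1) + 1 :=
    (Nat.sub_add_cancel Fintype.card_pos).symm
  set K := Fintype.card (Equiv.Perm (Fin n)) - 1 with hKdef
  let eC : Equiv.Perm (Fin n) ≃ Fin (K + 1) := Fintype.equivFinOfCardEq hK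
  let q : Fin (K + 1) → (Fin (n * n) → ℝ) := fun j => qPerm n (lam n) (eC.symm j)
  have hcard : Fintype.card (TSlot n)
      = Fintype.card (Option (Fin (8 * n ^ 4 + 28 * n ^ 3 + 36 * n ^ 2 + 16 * n + 1))) := by
    rw [card_TSlot, Fintype.card_option, Fintype.card_fin]
  let eS : TSlot n ≃ Option (Fin (8 * n ^ 4 + 28 * n ^ 3 + 36 * n ^ 2 + 16 * n + 1)) :=
    Fintype.equivOfCardEq hcard
  have hrange : Set.range q = Set.range (qPerm n (lam n)) := by
    ext x; constructor
    · rintro ⟨j, rfl⟩; exact ⟨eC.symm j, rfl⟩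
    · rintro ⟨π, rfl⟩; exact ⟨eC π, by simp [q]⟩
  have hQ : HasEFOfSize (convexHull ℝ (Set.range q)) (8 * n ^ 4 + 28 * n ^ 3 + 36 * n ^ 2 + 16 * n + 1) := by
    rw [hrange]; exact (hasEFOfSize_qPerm n (lam n)).of_le (by nlinarith)
  have key := hn₀ n hnn₀ K q _ hQ mrow
    (fun a j => rho_q_le_mrow a (eC.symm j))
    (fun a => by
      obtain ⟨π, hπ⟩ := exists_rho_q_eq_mrow a
      refine ⟨eC π, ?_⟩
      show (udRow a.1 + flat a.2) ⬝ᵥ qPerm n (lam n) (eC.symm (eC π)) = mrow a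
      rw [Equiv.symm_apply_apply]; exact hπ)
    (fun a i => Urow a (eS.symm i)) (fun p i => Vcol p.1 (eC.symm p.2) (eS.symm i))
    (fun a i => Urow_nonneg a _) (fun p i => Vcol_nonneg hn1 _ _ _)
    (fun a b j => by
      show ((1 + ∑ i, ∑ m, max (a.2 i m) 0) + mrow a) - (udRow a.1 + flat a.2) ⬝ᵥ
          (udPt b + qPerm n (lam n) (eC.symm j)) = ∑ i, Urow a (eS.symm i) * Vcol b (eC.symm j) (eS.symm i)
      rw [slack_factor a b (eC.symm j)]
      exact (Equiv.sum_comp eS.symm (fun s => Urow a s * Vcol b (eC.symm j) s)).symm)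
  have hle := card_TSlot_le_T_three n
  omega

end

end Summit.ValiantsHypothesis.Theorems.NNDivisionHardNegative.LocatedPencil
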